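import Summits.QuantumFields.YangMills.Theorems.BalabanUVNodesN20BankedRecordPriceOfT4Banking
import Literature.MathematicalPhysics.QuantumFieldTheory.Balaban1983to89.T4CanonicalMenus

/-!
# N20 (NE7b), ITEM (c)+(ID) BY NAME FROM `pub-balaban`'s BRANCHING RECORDS: the road-[e] stock budget with the candidates filed under (birth slot, TREE SHAPE) — the multiplicity of a
# fibre `≤ M^{partnerAges}` FOLDS INTO THE AGE FACTOR `θ = M·e^{−κ₁}` of `T4BranchingRecordsGas.treeWt` (the window surplus pays the partners' birth cells, `T4PartnerMultiplicity`), the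
# shapes counted by `bslotPriceT_le` over the menus' fuel-bounded families `fam`, the candidates priced by `T4BankedInduction` under ANY `Banking`; the K-UNIFORM answer to the
# multiplicity caveat of the records-as-sets faces (✓p771116 §2 ∕ ✓p773984): no per-event product multiplicity `n_b·Π n_e`, no condition `M·e^{−κ₁} ≤ 1`

Cell `pub-ymgap`, YM-PLAN Track A (HUMAN RULING D-0062); seat `pub-ymgap-dag-n20-d` (R134 (a) N20 NE7b s3), gen 41 — inside director-ym №374 line (E) ∕ item (c); road [e] TOWER-FREE of
record (№377).  `--kind proof --supports stmt-QuantumFields-27366 --as helper` (K3⁸); COUNT-NEUTRAL; THEOREMS ONLY (0 `def`).  [LF-II] = [Balaban1989LargeFieldII].  Companions BY NAME: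
`…N20FinalLevelBankedBudget.{sum_stock_le_twoRate_of_slotPrices, sum_integral_le_weightKP_mul_sum_of_fibreDom}` (gen 40, p771116), `…N20BankedRecordPriceOfT4Banking.
componentPrice_of_labelling` (gen 41, p775278), and `pub-balaban`'s `T4BranchingRecordsGas.{fam, treeWt, npNR, bslotPriceT_le, treeShape_of_mulRawShape, treeShape_of_label, relabel,
shape, rootStep_of_mem_fam}`, `T4PartnerMultiplicity.{partnerAges, windowSurplus}`, `T4BankedInduction.{Banking, credits, lifeCost}`, `T4PersistenceDictionary.{Gen, PEv, dictW}`,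
`T4PrintedShapeBanking.{Consts, Consistent, cost, credit, Emarg, reserve, extn}`, `T4RecordPriceSeam.{rho, eta}`.

WHY (the seat's memo `N20-R1-STRUCK.g41.md`, §3 (ID) caveat).  The records-as-SETS faces of road [e] carry a multiplicity binder `#fibre(slot, kind, record) ≤ n_b·Π_{e∈Q} n_e` with a
per-step budget `η̄` — but a record-as-set does not fix the birth cells of the PARTNERS merged into a structure, whose multiplicity `≍ Λ^{Σ partner ages}` is not of per-event product form
uniformly in the cutoff (`T4PartnerMultiplicity`'s located point).  `pub-balaban` re-indexed its count by BRANCHING RECORDS (`T4BranchingRecordsGas`): genealogy terms over LABELS `δ`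
built time-ordered from menus (`fam Lren Lmer Lpart n Lb s K`: renewal labels `Lren t`, merger labels `Lmer t`, partner-root labels `Lpart s′`, root labels `Lb`, fuel `n`), priced by the
TREE WEIGHT `treeWt ρ η θ st G = ρ(root)·θ^{partnerAges}·npNR η G` and summed per slot by `bslotPriceT_le` to EXACTLY the per-slot two-rate shape `ρ̄e^{−κ₁}·(e^{η̄₊−κ₁})^{K−j}` our
slot budget `sum_stock_le_twoRate_of_slotPrices` consumes; the AGE FACTOR `θ` carries any per-partner-step multiplicity, its only price being the menus' fixed-point side condition
`(a + μν·θ∕(1 − θe^{η̄₊}))·e^{η̄₊} ≤ e^{η̄₊} − 1` and `θe^{η̄₊} < 1` (NO `θ ≤ 1`).  THIS FILE files the candidates of a road-[e] stock under (birth slot, shape `shp Y ∈ fam …`): (§1) a fibre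
of candidates each priced by the telescoped tree shape `e^{−κ₁(K+1−j)}·treeWt ρ η θ₀ st G` with `#fibre ≤ M^{partnerAges st G}` is priced by the SAME shape at `θ = M·θ₀`
(`fibreSum_le_treeWt`, `mul_pow`); the slot sum by `bslotPriceT_le` (`slotSum_le_twoRate_of_treePrices`); (§2) the stock budget by p771116's `sum_stock_le_twoRate_of_slotPrices`
(`sum_stock_le_twoRate_of_treePrices`); (§3) the telescoped tree shape of ONE candidate labelled by an admissible well-formed pending genealogy with its partner ages below its window surplus,
under ANY `Banking` (`treePrice_of_labelling` = p775278's `componentPrice_of_labelling` + the generic bridge `treeShape_of_mulRawShape` at `M = 1`), hence ★★★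
`sum_stock_le_twoRate_of_branchingGenealogies` (generic labels); (§4) at the dictionary: candidates labelled by CONSISTENT well-formed pending genealogies `G Y : Gen PEv` whose
SHAPES `relabel shape (G Y)` are the counted branching records (`treeShape_of_label` BY NAME), weights `rho C g`, `eta C` of `T4RecordPriceSeam`, displayed menu budgets — ★★★
`sum_stock_le_twoRate_of_branchingLabels`; (§5) the socket of p771116 with `hw` so discharged.  After this file road [e]'s (ID) residue is: the menus with their four budgets (discharged
for the CANONICAL menus by `T4CanonicalMenus` — not re-derived here), the shape membership `relabel shape (G Y) ∈ fam …`, and the fibre multiplicity `≤ M^{partnerAges}` — the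
partners' birth cells, K-uniformly payable.

WHAT IS PROVED (kernel; finite sums + compositions BY NAME; zero `sorry`).
§1 `fibreSum_le_treeWt`, ★★ `slotSum_le_twoRate_of_treePrices`.  §2 ★★ `sum_stock_le_twoRate_of_treePrices`.  §3 ★ `treePrice_of_labelling`, ★★★ `sum_stock_le_twoRate_of_branchingGenealogies`.
§4 ★★★ `sum_stock_le_twoRate_of_branchingLabels` (dictionary, shapes, `Consistent`, any printed-shape `Banking`).  §5 ★★★ `sum_integral_le_weightKP_mul_sum_of_branchingLabels` (socket).

HONEST FRAMING.  [bookkeeping]: compositions by name; no estimate.  DISPLAYED and NOT proved here: the fibrewise letters (a) (junction NC-NE7b-α UNRULED); the removal ∕ fibre ∕ filing data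
and THE LABELLING by consistent well-formed pending genealogies with activities below their raw factors ((b) + `pub-balaban`'s (ID)-a∕b∕c + R3′ — the one wall); the shape memberships,
the fibre multiplicities `M^{partnerAges}`, the menus and their budgets `ρ̄, a, μ, ν`, the side condition ((ID); `T4CanonicalMenus` discharges the budgets for the canonical menus); the
cells; the `Banking` ((B): `T4PrintedShapeBanking.exists_irThreshold` from the typed flow + one infrared threshold).  NO inequality of Bałaban's is asserted; NE7 ∕ NE7b ∕ NE7c NOT
PRINTED for `d = 4` ∕ NOT proved; no `Provisos` inhabitant claimed; K3⁸ untouched; N20 NOT discharged; counts UNMOVED (typed 28∕28 · discharged 8∕27); one finite four-torus programme at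
fixed `ε` — NOT ℝ⁴, NOT OS, NOT a mass gap, NOT the Clay problem.  No `def`, no `instance`, no `notation`, no `sorry`; no decl below carries a cite tag.

v1.1 (APPEND-ONLY §6; every v1 declaration byte-identical; the import `T4BranchingRecordsGas` widened to its importer `T4CanonicalMenus` ← `T4TaggedShapeBanking`): ★★★
`sum_stock_le_twoRate_of_canonicalLabels` — §4 over `pub-balaban`'s CANONICAL MENUS (`T4CanonicalMenus.canonFam Dcap Ncap`: renewal ∕ merger menus `menuRen` ∕ `menuMer` = ONE shape
per step, root ∕ partner menus = the dictionary's birth kinds `dictB Dcap`): the step-faithfulness `hst` and the FOUR BUDGETS are DISCHARGED BY NAME (`menuMer_step`, `sum_menuRen_eta`,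
`sum_menuMer_eta`: `a = μ = e^{−E₀}`; `sum_dictB_eta_le`, `sum_dictB_rho_le`: `ν = ρ̄ = birthMass C` for `μ > 0` and a nonnegative profile along the run); what stays displayed of (ID) is
the shape membership `relabel shape (G Y) ∈ canonFam Dcap Ncap K j` (⇐ chronology + caps, `T4CanonicalMenus.mem_canonFam_of_chrono`), the fibre multiplicity `M^{partnerAges}` and ONE
numeric side condition on `(E₀, Eb, μ, κ₁, M, η̄₊)`.
-/

noncomputable section

open MeasureTheory
open Finset
open scoped BigOperators

namespace YMDAG.UVSplit

open Literature.MathematicalPhysics.QuantumFieldTheory.Balaban1983to89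
open Literature.MathematicalPhysics.QuantumFieldTheory.Balaban1983to89.B15.BasicStep (fibreIntegral)
open T4PersistenceDictionary (Gen PEv dictW)
open T4BankedInduction (Banking credits lifeCost)
open T4PartnerMultiplicity (partnerAges windowSurplus)
open T4BranchingRecordsGas (fam treeWt npNR npNR_nonneg treeWt_nonneg bslotPriceT_le treeShape_of_mulRawShape treeShape_of_label relabel shape rootStep_of_mem_fam)
open T4PrintedShapeBanking (Consistent)
open T4RecordPriceSeam (rho eta rho_pos eta_pos)

/-! ## §1 A fibre of equally shaped candidates: the multiplicity folds into the age factor; the slot sum by `bslotPriceT_le` -/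

section Fibre

variable {X δ : Type*} [DecidableEq δ]

omit [DecidableEq δ] in
/-- **THE FIBRE MULTIPLICITY FOLDS INTO THE AGE FACTOR**: a fibre `T` of candidates each priced by the telescoped tree shape `x Y ≤ E·treeWt ρ η θ₀ st G` of ONE shape `G` (`E ≥ 0` the
span factor, `ρ(root G) ≥ 0`, `η ≥ 0`, `θ₀ ≥ 0`) with `#T ≤ M^{partnerAges st G}` has `Σ_T x ≤ E·treeWt ρ η (M·θ₀) st G` — `treeWt` is homogeneous of degree `partnerAges` in
the age factor (`mul_pow`).  No smallness of `M`. [folklore] -/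
theorem fibreSum_le_treeWt (T : Finset X) (x : X → ℝ) {ρ η : δ → ℝ} {θ₀ M E : ℝ} {st : δ → ℕ} {G : Gen δ} (hE : 0 ≤ E) (hρ : 0 ≤ ρ G.root)
    (hη : ∀ e, 0 ≤ η e) (hθ : 0 ≤ θ₀) (hx : ∀ Y ∈ T, x Y ≤ E * treeWt ρ η θ₀ st G) (hcard : (T.card : ℝ) ≤ M ^ partnerAges st G) :
    ∑ Y ∈ T, x Y ≤ E * treeWt ρ η (M * θ₀) st G := by
  have h1 : ∑ Y ∈ T, x Y ≤ (T.card : ℝ) * (E * treeWt ρ η θ₀ st G) := by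
    have h := Finset.sum_le_card_nsmul T x _ hx
    rwa [nsmul_eq_mul] at h
  have h0 : 0 ≤ E * treeWt ρ η θ₀ st G := mul_nonneg hE (mul_nonneg (mul_nonneg hρ (pow_nonneg hθ _)) (npNR_nonneg hη G))
  have h2 : (T.card : ℝ) * (E * treeWt ρ η θ₀ st G) ≤ M ^ partnerAges st G * (E * treeWt ρ η θ₀ st G) := mul_le_mul_of_nonneg_right hcard h0
  have h3 : M ^ partnerAges st G * (E * treeWt ρ η θ₀ st G) = E * treeWt ρ η (M * θ₀) st G := by
    unfold treeWt; rw [mul_pow]; ring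
  linarith

/-- ★★ **ONE SLOT'S SUM OVER CANDIDATES FILED BY SHAPE** (`T4BranchingRecordsGas.bslotPriceT_le` BY NAME on the fibre sums): candidates `S` at a slot born at `j ≤ K`, each carrying a shape
`shp Y` in the menus' family `fam Lren Lmer Lpart n Lb j K`, the fibre of every shape priced by the telescoped tree shape `e^{−κ₁(K+1−j)}·treeWt ρ η θ st G`, menu budgets `Σ_{Lren t} η ≤ a`,
`Σ_{Lmer t} η ≤ μ`, `Σ_{Lpart s} η ≤ ν`, `Σ_{Lb} ρ ≤ ρ̄`, age factor `θ ≥ 0` with `θe^{η̄₊} < 1` and the side condition ⇒ `Σ_S x ≤ ρ̄e^{−κ₁}·(e^{η̄₊−κ₁})^{K−j}` — symbol for symbol the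
per-slot price of `sum_stock_le_twoRate_of_slotPrices`. [bookkeeping] -/
theorem slotSum_le_twoRate_of_treePrices (S : Finset X) (shp : X → Gen δ) (x : X → ℝ) (Lren Lmer Lpart : ℕ → Finset δ) (st : δ → ℕ)
    (hst : ∀ t, ∀ e ∈ Lmer t, st e = t) (η : δ → ℝ) (hη : ∀ e, 0 ≤ η e) {a μ ν θ ηplus : ℝ} (hθ : 0 ≤ θ) (hηplus : 0 ≤ ηplus)
    (ha : ∀ t, ∑ e ∈ Lren t, η e ≤ a) (hμ : ∀ t, ∑ e ∈ Lmer t, η e ≤ μ) (hν : ∀ s, ∑ b ∈ Lpart s, η b ≤ ν) (h1 : θ * Real.exp ηplus < 1)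
    (hside : (a + μ * ν * (θ / (1 - θ * Real.exp ηplus))) * Real.exp ηplus ≤ Real.exp ηplus - 1)
    (n : ℕ) (ρ : δ → ℝ) (hρ : ∀ b, 0 ≤ ρ b) (Lb : Finset δ) {ρbar : ℝ} (hρbar : ∑ b ∈ Lb, ρ b ≤ ρbar) {κ₁ : ℝ} {j K : ℕ} (hjK : j ≤ K)
    (hfam : ∀ Y ∈ S, shp Y ∈ fam Lren Lmer Lpart n Lb j K)
    (htree : ∀ G ∈ fam Lren Lmer Lpart n Lb j K, ∑ Y ∈ S with shp Y = G, x Y ≤ Real.exp (-(κ₁ * ((K + 1 - j : ℕ) : ℝ))) * treeWt ρ η θ st G) :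
    ∑ Y ∈ S, x Y ≤ ρbar * Real.exp (-κ₁) * Real.exp (ηplus - κ₁) ^ (K - j) := by
  rw [← Finset.sum_fiberwise_of_maps_to hfam x]
  exact bslotPriceT_le Lren Lmer Lpart st hst η hη hθ hηplus ha hμ hν h1 hside n ρ hρ Lb hρbar hjK (fun G => ∑ Y ∈ S with shp Y = G, x Y) htree

end Fibre

/-! ## §2 The stock budget from telescoped tree prices (p771116's slot budget ∘ §1) -/

section Stock

variable {X γ δ : Type*} [DecidableEq γ] [DecidableEq δ]

/-- ★★ **THE ROAD-[e] STOCK BUDGET FROM TELESCOPED TREE PRICES**: candidates filed under birth slots (old: `< j⋆ ≤ K`; cells `#Cell a ≤ V·Λ^a`) AND shapes `shp Y ∈ fam … n (Lb j) j K`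
(root menu `Lb j` per birth step), the fibre of every (slot, shape) priced by `e^{−κ₁(K+1−j)}·treeWt ρ η θ st G`, menu budgets and the age datum as in §1, root rate `Λ·e^{η̄₊−κ₁} < 1` ⇒
`Σ_{Y ∈ Old} x Y ≤ ρ̄e^{−κ₁}·V·(Λσ)^{K − j⋆ + 1}∕(1 − Λσ)`, `σ = e^{η̄₊−κ₁}` (`sum_stock_le_twoRate_of_slotPrices` ∘ `slotSum_le_twoRate_of_treePrices`). [bookkeeping] -/
theorem sum_stock_le_twoRate_of_treePrices (Old : Finset X) (slot : X → (Σ _ : ℕ, γ)) (shp : X → Gen δ) (x : X → ℝ)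
    (Cell : ℕ → Finset γ) {V Λ : ℝ} (hV : 0 ≤ V) (hΛ : 0 ≤ Λ) (hcell : ∀ a, ((Cell a).card : ℝ) ≤ V * Λ ^ a)
    (Lren Lmer Lpart : ℕ → Finset δ) (st : δ → ℕ) (hst : ∀ t, ∀ e ∈ Lmer t, st e = t) (η : δ → ℝ) (hη : ∀ e, 0 ≤ η e)
    {a μ ν θ ηplus : ℝ} (hθ : 0 ≤ θ) (hηplus : 0 ≤ ηplus) (ha : ∀ t, ∑ e ∈ Lren t, η e ≤ a) (hμ : ∀ t, ∑ e ∈ Lmer t, η e ≤ μ) (hν : ∀ s, ∑ b ∈ Lpart s, η b ≤ ν)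
    (h1 : θ * Real.exp ηplus < 1) (hside : (a + μ * ν * (θ / (1 - θ * Real.exp ηplus))) * Real.exp ηplus ≤ Real.exp ηplus - 1)
    (n : ℕ) (ρ : δ → ℝ) (hρ : ∀ b, 0 ≤ ρ b) (Lb : ℕ → Finset δ) {ρbar : ℝ} (hρbar0 : 0 ≤ ρbar) (hρbar : ∀ j, ∑ b ∈ Lb j, ρ b ≤ ρbar) {κ₁ : ℝ}
    (hr : Λ * Real.exp (ηplus - κ₁) < 1) {jstar K : ℕ} (hj : jstar ≤ K)
    (hold : ∀ Y ∈ Old, (slot Y).1 < jstar) (hmem : ∀ Y ∈ Old, (slot Y).2 ∈ Cell (K - (slot Y).1))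
    (hfam : ∀ Y ∈ Old, shp Y ∈ fam Lren Lmer Lpart n (Lb (slot Y).1) (slot Y).1 K)
    (htree : ∀ j < jstar, ∀ z ∈ Cell (K - j), ∀ G ∈ fam Lren Lmer Lpart n (Lb j) j K,
      ∑ Y ∈ Old with (slot Y = ⟨j, z⟩ ∧ shp Y = G), x Y ≤ Real.exp (-(κ₁ * ((K + 1 - j : ℕ) : ℝ))) * treeWt ρ η θ st G) :
    ∑ Y ∈ Old, x Y ≤ ρbar * Real.exp (-κ₁) * V * ((Λ * Real.exp (ηplus - κ₁)) ^ (K - jstar + 1) / (1 - Λ * Real.exp (ηplus - κ₁))) := by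
  refine sum_stock_le_twoRate_of_slotPrices Old slot x Cell hV hΛ (mul_nonneg hρbar0 (Real.exp_pos _).le) (Real.exp_pos _).le hr hcell hj hold hmem ?_
  intro j hjlt z hz
  refine slotSum_le_twoRate_of_treePrices (Old.filter fun Y => slot Y = ⟨j, z⟩) shp x Lren Lmer Lpart st hst η hη hθ hηplus ha hμ hν h1 hside n ρ hρ (Lb j) (hρbar j)
    (le_trans (le_of_lt hjlt) hj) (fun Y hY => ?_) (fun G hG => ?_)
  · obtain ⟨hO, hs⟩ := Finset.mem_filter.1 hY
    have h := hfam Y hO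
    rwa [hs] at h
  · have h := htree j hjlt z hz G hG
    simp only [Finset.filter_filter]
    exact h

end Stock

/-! ## §3 One labelled candidate's telescoped tree price under ANY banking; the budget for genealogy-labelled stocks -/

section Labelled

variable {X γ δ : Type*} [DecidableEq γ] [DecidableEq δ]

/-- ★ **THE TELESCOPED TREE PRICE OF ONE LABELLED CANDIDATE** (p775278's `componentPrice_of_labelling` + `T4BranchingRecordsGas.treeShape_of_mulRawShape` at `M = 1`): under ANY
`Banking` with banks `κ₁·W + E` (`κ₁ ≥ 0`), a candidate labelled by an admissible well-formed genealogy `G` pending at `K` whose partner ages are below its window surplus, with activity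
`x ≤ e^{−credits G}·e^{+lifeCost G}`, is priced `x ≤ e^{−κ₁(K+1−rootStep G)}·treeWt ρ η e^{−κ₁} st G` with `ρ b = e^{−(reserve b + E b)}`, `η e = e^{−E e}`. [bookkeeping] -/
theorem treePrice_of_labelling {adm : Gen δ → Prop} {W : δ → ℕ} {cost : Gen δ → ℕ → ℝ} {credit Emg reserve : δ → ℝ} {ext : Gen δ → Gen δ → δ → ℝ} {κ₁ : ℝ}
    (hκ : 0 ≤ κ₁) (B : Banking adm W cost credit (fun e => κ₁ * (W e : ℝ) + Emg e) reserve ext) (st : δ → ℕ) {G : Gen δ} (hadm : adm G) (hwf : G.WF W)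
    {K : ℕ} (hpend : K < G.reach W) (hsur : partnerAges st G ≤ windowSurplus W G) {x : ℝ}
    (hx : x ≤ Real.exp (-credits credit G) * Real.exp (lifeCost W cost G)) :
    x ≤ Real.exp (-(κ₁ * ((K + 1 - G.rootStep : ℕ) : ℝ))) *
      treeWt (fun b => Real.exp (-(reserve b + Emg b))) (fun e => Real.exp (-Emg e)) (1 * Real.exp (-κ₁)) st G :=
  treeShape_of_mulRawShape (ρ := fun b => Real.exp (-(reserve b + Emg b))) (η := fun e => Real.exp (-Emg e)) hκ zero_le_one hwf (Real.exp_pos _).le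
    (fun _ => Real.exp_pos _) hpend hsur (by rw [one_pow, one_mul]; exact componentPrice_of_labelling B hadm hwf hx)

/-- ★★★ **THE ROAD-[e] STOCK BUDGET FOR A STOCK LABELLED BY PENDING GENEALOGIES, MULTIPLICITY-TOLERANT, UNDER ANY BANKING** (§2 ∘ §3 ∘ `fibreSum_le_treeWt`): candidates filed under
birth slots, each LABELLED by an admissible well-formed genealogy `G Y` pending at `K`, partner ages below the window surplus, in the menus' family `fam … n (Lb j) j K` of its birth
step, activity below its raw factor; at most `M^{partnerAges st (G Y)}` candidates per (slot, genealogy) (the partners' birth cells — `M ≥ 0`, NO smallness); menus with budgets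
`Σ_{Lb j} e^{−(reserve b + E b)} ≤ ρ̄`, `Σ_{Lren t} e^{−E e} ≤ a`, `Σ_{Lmer t} e^{−E e} ≤ μ`, `Σ_{Lpart s} e^{−E b} ≤ ν`; age factor `θ = M·e^{−κ₁}` with `θe^{η̄₊} < 1` and the side
condition; root rate `Λ·e^{η̄₊−κ₁} < 1` ⇒ `Σ_{Y ∈ Old} x Y ≤ ρ̄e^{−κ₁}·V·(Λσ)^{K − j⋆ + 1}∕(1 − Λσ)`, `σ = e^{η̄₊−κ₁}`. [bookkeeping] -/
theorem sum_stock_le_twoRate_of_branchingGenealogies (Old : Finset X) (slot : X → (Σ _ : ℕ, γ)) (G : X → Gen δ) (x : X → ℝ)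
    (Cell : ℕ → Finset γ) {V Λ : ℝ} (hV : 0 ≤ V) (hΛ : 0 ≤ Λ) (hcell : ∀ a, ((Cell a).card : ℝ) ≤ V * Λ ^ a)
    {adm : Gen δ → Prop} {W : δ → ℕ} {cost : Gen δ → ℕ → ℝ} {credit Emg reserve : δ → ℝ} {ext : Gen δ → Gen δ → δ → ℝ} {κ₁ : ℝ} (hκ : 0 ≤ κ₁)
    (B : Banking adm W cost credit (fun e => κ₁ * (W e : ℝ) + Emg e) reserve ext)
    (Lren Lmer Lpart : ℕ → Finset δ) (st : δ → ℕ) (hst : ∀ t, ∀ e ∈ Lmer t, st e = t) {a μ ν M ηplus : ℝ} (hM : 0 ≤ M) (hηplus : 0 ≤ ηplus)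
    (ha : ∀ t, ∑ e ∈ Lren t, Real.exp (-Emg e) ≤ a) (hμ : ∀ t, ∑ e ∈ Lmer t, Real.exp (-Emg e) ≤ μ) (hν : ∀ s, ∑ b ∈ Lpart s, Real.exp (-Emg b) ≤ ν)
    (h1 : M * Real.exp (-κ₁) * Real.exp ηplus < 1)
    (hside : (a + μ * ν * (M * Real.exp (-κ₁) / (1 - M * Real.exp (-κ₁) * Real.exp ηplus))) * Real.exp ηplus ≤ Real.exp ηplus - 1)
    (n : ℕ) (Lb : ℕ → Finset δ) {ρbar : ℝ} (hρbar0 : 0 ≤ ρbar) (hρbar : ∀ j, ∑ b ∈ Lb j, Real.exp (-(reserve b + Emg b)) ≤ ρbar)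
    (hr : Λ * Real.exp (ηplus - κ₁) < 1) {jstar K : ℕ} (hj : jstar ≤ K)
    (hold : ∀ Y ∈ Old, (slot Y).1 < jstar) (hmem : ∀ Y ∈ Old, (slot Y).2 ∈ Cell (K - (slot Y).1))
    (hadm : ∀ Y ∈ Old, adm (G Y)) (hwf : ∀ Y ∈ Old, (G Y).WF W) (hpend : ∀ Y ∈ Old, K < (G Y).reach W)
    (hsur : ∀ Y ∈ Old, partnerAges st (G Y) ≤ windowSurplus W (G Y))
    (hfam : ∀ Y ∈ Old, G Y ∈ fam Lren Lmer Lpart n (Lb (slot Y).1) (slot Y).1 K)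
    (hx : ∀ Y ∈ Old, x Y ≤ Real.exp (-credits credit (G Y)) * Real.exp (lifeCost W cost (G Y)))
    (hcard : ∀ j < jstar, ∀ z ∈ Cell (K - j), ∀ G₀ ∈ fam Lren Lmer Lpart n (Lb j) j K,
      (((Old.filter fun Y => slot Y = ⟨j, z⟩ ∧ G Y = G₀).card : ℕ) : ℝ) ≤ M ^ partnerAges st G₀) :
    ∑ Y ∈ Old, x Y ≤ ρbar * Real.exp (-κ₁) * V * ((Λ * Real.exp (ηplus - κ₁)) ^ (K - jstar + 1) / (1 - Λ * Real.exp (ηplus - κ₁))) := by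
  refine sum_stock_le_twoRate_of_treePrices Old slot G x Cell hV hΛ hcell Lren Lmer Lpart st hst (fun e => Real.exp (-Emg e)) (fun _ => (Real.exp_pos _).le)
    (mul_nonneg hM (Real.exp_pos _).le) hηplus ha hμ hν h1 hside n (fun b => Real.exp (-(reserve b + Emg b))) (fun _ => (Real.exp_pos _).le) Lb hρbar0 hρbar hr hj
    hold hmem hfam ?_
  intro j hjlt z hz G₀ hG₀
  have hroot : G₀.rootStep = j := rootStep_of_mem_fam n (Lb j) j K G₀ hG₀
  refine fibreSum_le_treeWt (Old.filter fun Y => slot Y = ⟨j, z⟩ ∧ G Y = G₀) x (Real.exp_pos _).le (Real.exp_pos _).le (fun _ => (Real.exp_pos _).le)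
    (Real.exp_pos _).le (fun Y hY => ?_) (hcard j hjlt z hz G₀ hG₀)
  obtain ⟨hO, -, hG⟩ := Finset.mem_filter.1 hY
  have h := treePrice_of_labelling hκ B st (hadm Y hO) (hwf Y hO) (hpend Y hO) (hsur Y hO) (hx Y hO)
  rw [hG, hroot, one_mul] at h
  exact h

end Labelled

/-! ## §4 At the dictionary: labels by CONSISTENT genealogies, shapes counted as branching records (`treeShape_of_label` by name) -/

section Dictionary

variable {X γ : Type*} [DecidableEq γ]

/-- ★★★ **THE STOCK BUDGET AT THE DICTIONARY WITH SHAPES COUNTED AS BRANCHING RECORDS**: a `Banking` of the printed shapes at cutoff `K` along the run `(R, g)` (hypothesis `B` — from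
`T4PrintedShapeBanking.exists_irThreshold`), candidates filed under birth slots, each LABELLED by a CONSISTENT well-formed genealogy `G Y : Gen PEv` pending at `K` (so its partner ages are
below its window surplus — `T4PartnerMultiplicity.partnerAges_le_windowSurplus`, inside `treeShape_of_label`) with activity below its raw factor, whose SHAPE `relabel shape (G Y)` lies
in the menus' family of its birth step; at most `M^{partnerAges (shape)}` candidates per (slot, shape); menu budgets in the model's weights `rho C g` ∕ `eta C`; age datum and root rate ⇒
`Σ_{Y ∈ Old} x Y ≤ ρ̄e^{−κ₁}·V·(Λσ)^{K − j⋆ + 1}∕(1 − Λσ)`, `σ = e^{η̄₊−κ₁}`, `κ₁ = C.κ₁`. [bookkeeping] -/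
theorem sum_stock_le_twoRate_of_branchingLabels (C : T4PrintedShapeBanking.Consts) (hκ : 0 ≤ C.κ₁) {K : ℕ} {R : ℕ → ℕ} {g : ℕ → ℝ}
    (B : Banking (Consistent C K R) (dictW R C.n₁) (T4PrintedShapeBanking.cost C K R) (T4PrintedShapeBanking.credit C g)
      (fun e => C.κ₁ * ((dictW R C.n₁ e : ℕ) : ℝ) + T4PrintedShapeBanking.Emarg C e) (T4PrintedShapeBanking.reserve C g) (T4PrintedShapeBanking.extn C K R))
    (Old : Finset X) (slot : X → (Σ _ : ℕ, γ)) (G : X → Gen PEv) (x : X → ℝ)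
    (Cell : ℕ → Finset γ) {V Λ : ℝ} (hV : 0 ≤ V) (hΛ : 0 ≤ Λ) (hcell : ∀ a, ((Cell a).card : ℝ) ≤ V * Λ ^ a)
    (Lren Lmer Lpart : ℕ → Finset PEv) (hst : ∀ t, ∀ e ∈ Lmer t, PEv.step e = t) {a μ ν M ηplus : ℝ} (hM : 0 ≤ M) (hηplus : 0 ≤ ηplus)
    (ha : ∀ t, ∑ e ∈ Lren t, eta C e ≤ a) (hμ : ∀ t, ∑ e ∈ Lmer t, eta C e ≤ μ) (hν : ∀ s, ∑ b ∈ Lpart s, eta C b ≤ ν)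
    (h1 : M * Real.exp (-C.κ₁) * Real.exp ηplus < 1)
    (hside : (a + μ * ν * (M * Real.exp (-C.κ₁) / (1 - M * Real.exp (-C.κ₁) * Real.exp ηplus))) * Real.exp ηplus ≤ Real.exp ηplus - 1)
    (n : ℕ) (Lb : ℕ → Finset PEv) {ρbar : ℝ} (hρbar0 : 0 ≤ ρbar) (hρbar : ∀ j, ∑ b ∈ Lb j, rho C g b ≤ ρbar)
    (hr : Λ * Real.exp (ηplus - C.κ₁) < 1) {jstar : ℕ} (hj : jstar ≤ K)
    (hold : ∀ Y ∈ Old, (slot Y).1 < jstar) (hmem : ∀ Y ∈ Old, (slot Y).2 ∈ Cell (K - (slot Y).1))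
    (hcon : ∀ Y ∈ Old, Consistent C K R (G Y)) (hwf : ∀ Y ∈ Old, (G Y).WF (dictW R C.n₁)) (hpend : ∀ Y ∈ Old, K < (G Y).reach (dictW R C.n₁))
    (hfam : ∀ Y ∈ Old, relabel shape (G Y) ∈ fam Lren Lmer Lpart n (Lb (slot Y).1) (slot Y).1 K)
    (hx : ∀ Y ∈ Old, x Y ≤ Real.exp (-credits (T4PrintedShapeBanking.credit C g) (G Y)) * Real.exp (lifeCost (dictW R C.n₁) (T4PrintedShapeBanking.cost C K R) (G Y)))
    (hcard : ∀ j < jstar, ∀ z ∈ Cell (K - j), ∀ G₀ ∈ fam Lren Lmer Lpart n (Lb j) j K,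
      (((Old.filter fun Y => slot Y = ⟨j, z⟩ ∧ relabel shape (G Y) = G₀).card : ℕ) : ℝ) ≤ M ^ partnerAges PEv.step G₀) :
    ∑ Y ∈ Old, x Y ≤ ρbar * Real.exp (-C.κ₁) * V * ((Λ * Real.exp (ηplus - C.κ₁)) ^ (K - jstar + 1) / (1 - Λ * Real.exp (ηplus - C.κ₁))) := by
  refine sum_stock_le_twoRate_of_treePrices Old slot (fun Y => relabel shape (G Y)) x Cell hV hΛ hcell Lren Lmer Lpart PEv.step hst (eta C) (fun e => (eta_pos C e).le)
    (mul_nonneg hM (Real.exp_pos _).le) hηplus ha hμ hν h1 hside n (rho C g) (fun b => (rho_pos C g b).le) Lb hρbar0 hρbar hr hj hold hmem hfam ?_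
  intro j hjlt z hz G₀ hG₀
  have hroot : G₀.rootStep = j := rootStep_of_mem_fam n (Lb j) j K G₀ hG₀
  refine fibreSum_le_treeWt (Old.filter fun Y => slot Y = ⟨j, z⟩ ∧ relabel shape (G Y) = G₀) x (Real.exp_pos _).le (rho_pos C g _).le (fun e => (eta_pos C e).le)
    (Real.exp_pos _).le (fun Y hY => ?_) (hcard j hjlt z hz G₀ hG₀)
  obtain ⟨hO, -, hG⟩ := Finset.mem_filter.1 hY
  have h := treeShape_of_label hκ B zero_le_one (y := x Y) (G := G₀)
    (Or.inr ⟨G Y, hcon Y hO, hwf Y hO, hpend Y hO, hG, by rw [one_pow, one_mul]; exact hx Y hO⟩)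
  rw [hroot, one_mul] at h
  exact h

end Dictionary

/-! ## §5 The socket: the bad class weighs at most `1 − e^{−S_K}` of the total, `S_K` from the branching labels -/

section Socket

variable {P : Params} {Gg : Type*} [GaugeGroup Gg] [MeasurableSpace Gg] [HaarData Gg] {j : ℕ}
variable {ι : Type*} [Fintype ι] [DecidableEq ι]
variable {X γ : Type*} [DecidableEq X] [DecidableEq γ]

/-- ★★★ **THE FINAL-LEVEL SOCKET OF ROAD [e], ITS SMALLNESS FROM THE BRANCHING LABELS** (p771116's `sum_integral_le_weightKP_mul_sum_of_fibreDom` ∘ §4, per image `σ`): fibrewise letters on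
the bad set with good images whose factors are dominated by the products of the RAW FACTORS of the removed components' consistent well-formed pending genealogies ((a), on the ledger),
removal fibres injecting into the stocks `Old σ` ((b)), stocks filed by (birth slot, SHAPE) with fibre multiplicities `M^{partnerAges}`, menus and budgets ((ID)), cells, and a printed-shape
`Banking` at the cutoff ((B)) ⇒ `Σ_{s ∈ B} ∫ t_s ≤ (1 − e^{−S_K})·Σ_s ∫ t_s`, `S_K = ρ̄e^{−κ₁}·V·(Λσ)^{K − j⋆ + 1}∕(1 − Λσ)`. [bookkeeping] -/
theorem sum_integral_le_weightKP_mul_sum_of_branchingLabels {iP : DecidableEq (PBond P j)} (t : ι → Density P j Gg)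
    (fib : ι → Finset (PBond P j)) (Bad : Finset ι) (rm : ι → ι) (z : ι → ℝ)
    (hm : ∀ s, Measurable (t s)) (h0 : ∀ s V, 0 ≤ t s V) (hint : ∀ s, Integrable (t s) (fieldMeasure P j Gg))
    (hDom : ∀ s ∈ Bad, ∀ V, fibreIntegral (fib s) (t s) V ≤ z s * fibreIntegral (fib s) (t (rm s)) V)
    (hgood : ∀ s ∈ Bad, rm s ∉ Bad)
    (C : T4PrintedShapeBanking.Consts) (hκ : 0 ≤ C.κ₁) {K : ℕ} {R : ℕ → ℕ} {g : ℕ → ℝ}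
    (B : Banking (Consistent C K R) (dictW R C.n₁) (T4PrintedShapeBanking.cost C K R) (T4PrintedShapeBanking.credit C g)
      (fun e => C.κ₁ * ((dictW R C.n₁ e : ℕ) : ℝ) + T4PrintedShapeBanking.Emarg C e) (T4PrintedShapeBanking.reserve C g) (T4PrintedShapeBanking.extn C K R))
    (G : X → Gen PEv) (Old : ι → Finset X) (φ : ι → ι → Finset X)
    (hφ : ∀ σ, ∀ s ∈ Bad.filter (fun s => rm s = σ), φ σ s ⊆ Old σ ∧ (φ σ s).Nonempty) (hinj : ∀ σ, Set.InjOn (φ σ) (Bad.filter (fun s => rm s = σ)))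
    (hz : ∀ σ, ∀ s ∈ Bad.filter (fun s => rm s = σ), z s ≤ ∏ Y ∈ φ σ s,
      Real.exp (-credits (T4PrintedShapeBanking.credit C g) (G Y)) * Real.exp (lifeCost (dictW R C.n₁) (T4PrintedShapeBanking.cost C K R) (G Y)))
    (slot : X → (Σ _ : ℕ, γ)) (Cell : ℕ → Finset γ) {V Λ : ℝ} (hV : 0 ≤ V) (hΛ : 0 ≤ Λ) (hcell : ∀ a, ((Cell a).card : ℝ) ≤ V * Λ ^ a)
    (Lren Lmer Lpart : ℕ → Finset PEv) (hst : ∀ t, ∀ e ∈ Lmer t, PEv.step e = t) {a μ ν M ηplus : ℝ} (hM : 0 ≤ M) (hηplus : 0 ≤ ηplus)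
    (ha : ∀ t, ∑ e ∈ Lren t, eta C e ≤ a) (hμ : ∀ t, ∑ e ∈ Lmer t, eta C e ≤ μ) (hν : ∀ s, ∑ b ∈ Lpart s, eta C b ≤ ν)
    (h1 : M * Real.exp (-C.κ₁) * Real.exp ηplus < 1)
    (hside : (a + μ * ν * (M * Real.exp (-C.κ₁) / (1 - M * Real.exp (-C.κ₁) * Real.exp ηplus))) * Real.exp ηplus ≤ Real.exp ηplus - 1)
    (n : ℕ) (Lb : ℕ → Finset PEv) {ρbar : ℝ} (hρbar0 : 0 ≤ ρbar) (hρbar : ∀ j, ∑ b ∈ Lb j, rho C g b ≤ ρbar)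
    (hr : Λ * Real.exp (ηplus - C.κ₁) < 1) {jstar : ℕ} (hj : jstar ≤ K)
    (hold : ∀ σ, ∀ Y ∈ Old σ, (slot Y).1 < jstar) (hmem : ∀ σ, ∀ Y ∈ Old σ, (slot Y).2 ∈ Cell (K - (slot Y).1))
    (hcon : ∀ σ, ∀ Y ∈ Old σ, Consistent C K R (G Y)) (hwf : ∀ σ, ∀ Y ∈ Old σ, (G Y).WF (dictW R C.n₁)) (hpend : ∀ σ, ∀ Y ∈ Old σ, K < (G Y).reach (dictW R C.n₁))
    (hfam : ∀ σ, ∀ Y ∈ Old σ, relabel shape (G Y) ∈ fam Lren Lmer Lpart n (Lb (slot Y).1) (slot Y).1 K)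
    (hcard : ∀ σ, ∀ j < jstar, ∀ zc ∈ Cell (K - j), ∀ G₀ ∈ fam Lren Lmer Lpart n (Lb j) j K,
      ((((Old σ).filter fun Y => slot Y = ⟨j, zc⟩ ∧ relabel shape (G Y) = G₀).card : ℕ) : ℝ) ≤ M ^ partnerAges PEv.step G₀) :
    ∑ s ∈ Bad, ∫ V, t s V ∂fieldMeasure P j Gg ≤
      (1 - Real.exp (-(ρbar * Real.exp (-C.κ₁) * V * ((Λ * Real.exp (ηplus - C.κ₁)) ^ (K - jstar + 1) / (1 - Λ * Real.exp (ηplus - C.κ₁)))))) *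
        ∑ s, ∫ V, t s V ∂fieldMeasure P j Gg :=
  sum_integral_le_weightKP_mul_sum_of_fibreDom t fib Bad rm z hm h0 hint hDom hgood Old φ
    (fun Y => Real.exp (-credits (T4PrintedShapeBanking.credit C g) (G Y)) * Real.exp (lifeCost (dictW R C.n₁) (T4PrintedShapeBanking.cost C K R) (G Y)))
    (fun _ _ _ => (mul_pos (Real.exp_pos _) (Real.exp_pos _)).le) hφ hinj hz fun σ =>
    sum_stock_le_twoRate_of_branchingLabels C hκ B (Old σ) slot G _ Cell hV hΛ hcell Lren Lmer Lpart hst hM hηplus ha hμ hν h1 hside n Lb hρbar0 hρbar hr hj (hold σ) (hmem σ)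
      (hcon σ) (hwf σ) (hpend σ) (hfam σ) (fun _ _ => le_rfl) (hcard σ)

end Socket

/-! ## §6 (v1.1) Over the CANONICAL menus of `T4CanonicalMenus`: `hst` and the four budgets discharged by name -/

section Canonical

variable {X γ : Type*} [DecidableEq γ]

open T4CanonicalMenus (menuRen menuMer canonFam birthMass birthMass_nonneg menuMer_step sum_menuRen_eta sum_menuMer_eta sum_dictB_eta_le sum_dictB_rho_le)
open T4PersistenceDictionary (dictB)

/-- ★★★ **THE STOCK BUDGET AT THE DICTIONARY OVER THE CANONICAL MENUS** (§4 with `Lren := menuRen`, `Lmer := menuMer`, `Lpart := dictB Dcap K`, `Lb j := dictB Dcap K j`, fuel `Ncap K` —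
i.e. shapes in `canonFam Dcap Ncap K j` — and the menu data DISCHARGED: `hst := menuMer_step`, `a = μ := e^{−E₀}` (`sum_menuRen_eta`, `sum_menuMer_eta`), `ν = ρ̄ := birthMass C`
(`sum_dictB_eta_le`, `sum_dictB_rho_le`, for `μ > 0` and `0 ≤ p₀(g_j)` at every birth step)): a printed-shape `Banking` at cutoff `K`, candidates filed under birth slots and labelled by
CONSISTENT well-formed pending genealogies whose shapes are canonical branching records of their birth step, activities below raw factors, fibre multiplicities `≤ M^{partnerAges}`, the age
datum `M·e^{−κ₁}·e^{η̄₊} < 1` with the ONE side condition `(e^{−E₀} + e^{−E₀}·birthMass C·(Me^{−κ₁}∕(1 − Me^{−κ₁}e^{η̄₊})))·e^{η̄₊} ≤ e^{η̄₊} − 1`, root rate `Λ·e^{η̄₊−κ₁} < 1` ⇒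
`Σ_{Y ∈ Old} x Y ≤ birthMass C·e^{−κ₁}·V·(Λσ)^{K − j⋆ + 1}∕(1 − Λσ)`, `σ = e^{η̄₊−κ₁}`. [bookkeeping] -/
theorem sum_stock_le_twoRate_of_canonicalLabels (C : T4PrintedShapeBanking.Consts) (hκ : 0 ≤ C.κ₁) (hμ₀ : 0 < C.μ) {K : ℕ} {R : ℕ → ℕ} {g : ℕ → ℝ}
    (B : Banking (Consistent C K R) (dictW R C.n₁) (T4PrintedShapeBanking.cost C K R) (T4PrintedShapeBanking.credit C g)
      (fun e => C.κ₁ * ((dictW R C.n₁ e : ℕ) : ℝ) + T4PrintedShapeBanking.Emarg C e) (T4PrintedShapeBanking.reserve C g) (T4PrintedShapeBanking.extn C K R))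
    (hP : ∀ j, 0 ≤ p0Profile C.A₀ C.p₀ (g j)) (Dcap Ncap : ℕ → ℕ)
    (Old : Finset X) (slot : X → (Σ _ : ℕ, γ)) (G : X → Gen PEv) (x : X → ℝ)
    (Cell : ℕ → Finset γ) {V Λ : ℝ} (hV : 0 ≤ V) (hΛ : 0 ≤ Λ) (hcell : ∀ a, ((Cell a).card : ℝ) ≤ V * Λ ^ a)
    {M ηplus : ℝ} (hM : 0 ≤ M) (hηplus : 0 ≤ ηplus) (h1 : M * Real.exp (-C.κ₁) * Real.exp ηplus < 1)
    (hside : (Real.exp (-C.E₀) + Real.exp (-C.E₀) * birthMass C * (M * Real.exp (-C.κ₁) / (1 - M * Real.exp (-C.κ₁) * Real.exp ηplus))) * Real.exp ηplus ≤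
      Real.exp ηplus - 1)
    (hr : Λ * Real.exp (ηplus - C.κ₁) < 1) {jstar : ℕ} (hj : jstar ≤ K)
    (hold : ∀ Y ∈ Old, (slot Y).1 < jstar) (hmem : ∀ Y ∈ Old, (slot Y).2 ∈ Cell (K - (slot Y).1))
    (hcon : ∀ Y ∈ Old, Consistent C K R (G Y)) (hwf : ∀ Y ∈ Old, (G Y).WF (dictW R C.n₁)) (hpend : ∀ Y ∈ Old, K < (G Y).reach (dictW R C.n₁))
    (hfam : ∀ Y ∈ Old, relabel shape (G Y) ∈ canonFam Dcap Ncap K (slot Y).1)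
    (hx : ∀ Y ∈ Old, x Y ≤ Real.exp (-credits (T4PrintedShapeBanking.credit C g) (G Y)) * Real.exp (lifeCost (dictW R C.n₁) (T4PrintedShapeBanking.cost C K R) (G Y)))
    (hcard : ∀ j < jstar, ∀ z ∈ Cell (K - j), ∀ G₀ ∈ canonFam Dcap Ncap K j,
      (((Old.filter fun Y => slot Y = ⟨j, z⟩ ∧ relabel shape (G Y) = G₀).card : ℕ) : ℝ) ≤ M ^ partnerAges PEv.step G₀) :
    ∑ Y ∈ Old, x Y ≤ birthMass C * Real.exp (-C.κ₁) * V * ((Λ * Real.exp (ηplus - C.κ₁)) ^ (K - jstar + 1) / (1 - Λ * Real.exp (ηplus - C.κ₁))) :=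
  sum_stock_le_twoRate_of_branchingLabels C hκ B Old slot G x Cell hV hΛ hcell menuRen menuMer (dictB Dcap K) menuMer_step hM hηplus
    (fun t => (sum_menuRen_eta C t).le) (fun t => (sum_menuMer_eta C t).le) (fun s => sum_dictB_eta_le hμ₀ Dcap K s) h1 hside (Ncap K) (dictB Dcap K)
    (birthMass_nonneg hμ₀) (fun j => sum_dictB_rho_le hμ₀ Dcap K j (hP j)) hr hj hold hmem hcon hwf hpend hfam hx hcard

end Canonical

end YMDAG.UVSplit
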